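import Mathlib

/-!
# Route BarrierLever — item 20195 `ChowHitsThinRowPartitionMinors` is FALSE, V: existence of the
# certificate matrix `N` (dimension count)

Helper file (`--supports stmt-ValiantsHypothesis-20195`; cell valiant-natproofs, rung V4, 𝒟-side;
seat val-np-p2 gen 9).  Closes NO item; definition-free; imports only Mathlib.  Part of the kernel
REFUTATION of items 20195 / 20172 / 20239 (memo HOME/val-np-p2/g9/REFUTATION-20195-valnp2-g9.md,
§2 Step 2).

* `exists_certificate_matrix` — let `𝕄` be an invertible `h × h` matrix, `ω : Fin o → Fin h`
  injective (the STARVED block `O`), `A : ι → Fin h → ℂ` (the `x`-coefficients of the forms).  If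
  `h + |ι| < C(o+1, 2)` there is a symmetric zero-diagonal `N ≠ 0` with
  `Σ_{a,b} A k a · N a b · A k b = 0` for every `k` and `N · 𝕄 e = 0` for every column `e ∉ O`.
  Construction: `N = Gᵀ S G` with `G` = the rows of `adj 𝕄` indexed by `O` and `S` symmetric
  (`Sym2 (Fin o) → ℂ`, `C(o+1,2)` unknowns) solving the `h + |ι|` linear constraints
  (`LinearMap.ker_ne_bot_of_finrank_lt`); `adj 𝕄 · 𝕄 = det 𝕄 · 1` gives `G · 𝕄 e = 0` off `O` and
  a right inverse of `G`, whence `N ≠ 0`.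

WHAT THIS IS NOT: nothing on item 19717, on crux stmt-ValiantsHypothesis-14610, or on `VP` versus `VNP`.
-/

set_option linter.dupNamespace false

namespace Summit.ValiantsHypothesis.ValiantsHypothesis.Theorems.BarrierLever.ChowStarve

open Finset

variable {h : ℕ}

/-- Entries of `adj 𝕄 · 𝕄 = det 𝕄 · 1`. -/
theorem sum_adjugate_mul_apply (𝕄 : Matrix (Fin h) (Fin h) ℂ) (x y : Fin h) :
    ∑ b, 𝕄.adjugate x b * 𝕄 b y = if x = y then 𝕄.det else 0 := by
  have e := congrFun (congrFun (Matrix.adjugate_mul 𝕄) x) y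
  rw [Matrix.mul_apply, Matrix.smul_apply, Matrix.one_apply, smul_eq_mul, mul_ite, mul_one,
    mul_zero] at e
  exact e

/-- **Existence of the certificate matrix.** -/
theorem exists_certificate_matrix {ι : Type*} [Fintype ι] [DecidableEq ι] (o : ℕ)
    (ω : Fin o → Fin h) (hω : Function.Injective ω)
    (A : ι → Fin h → ℂ) (𝕄 : Matrix (Fin h) (Fin h) ℂ) (hdet : 𝕄.det ≠ 0)
    (hcount : h + Fintype.card ι < Nat.choose (o + 1) 2) :
    ∃ N : Fin h → Fin h → ℂ, (∀ a b, N a b = N b a) ∧ (∀ a, N a a = 0) ∧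
      (∀ k, ∑ a, ∑ b, A k a * N a b * A k b = 0) ∧
      (∀ e, e ∉ Set.range ω → ∀ a, ∑ b, N a b * 𝕄 b e = 0) ∧
      (∃ a b, a ≠ b ∧ N a b ≠ 0) := by
  classical
  -- the rows of the adjugate indexed by `O`, and the candidate `N(u) = Gᵀ S(u) G`
  set G : Fin o → Fin h → ℂ := fun i a => 𝕄.adjugate (ω i) a with hG
  set Nf : (Sym2 (Fin o) → ℂ) → Fin h → Fin h → ℂ :=
    fun u a b => ∑ i, ∑ j, G i a * u (s(i, j)) * G j b with hNf
  have hNf_add : ∀ u v a b, Nf (u + v) a b = Nf u a b + Nf v a b := by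
    intro u v a b
    simp only [hNf, Pi.add_apply, mul_add, add_mul, Finset.sum_add_distrib]
  have hNf_smul : ∀ (c : ℂ) u a b, Nf (c • u) a b = c * Nf u a b := by
    intro c u a b
    simp only [hNf, Pi.smul_apply, smul_eq_mul, Finset.mul_sum]
    exact Finset.sum_congr rfl fun i _ => Finset.sum_congr rfl fun j _ => by ring
  -- the linear constraint map
  let L : (Sym2 (Fin o) → ℂ) →ₗ[ℂ] ((Fin h → ℂ) × (ι → ℂ)) :=
    { toFun := fun u => (fun a => Nf u a a, fun k => ∑ a, ∑ b, A k a * Nf u a b * A k b)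
      map_add' := by
        intro u v
        refine Prod.ext (funext fun a => ?_) (funext fun k => ?_)
        · simp only [Prod.fst_add, Pi.add_apply, hNf_add]
        · simp only [Prod.snd_add, Pi.add_apply, hNf_add, mul_add, add_mul, Finset.sum_add_distrib]
      map_smul' := by
        intro c u
        refine Prod.ext (funext fun a => ?_) (funext fun k => ?_)
        · simp only [Prod.smul_fst, Pi.smul_apply, smul_eq_mul, RingHom.id_apply, hNf_smul]
        · simp only [Prod.smul_snd, Pi.smul_apply, smul_eq_mul, RingHom.id_apply, hNf_smul,
            Finset.mul_sum]
          exact Finset.sum_congr rfl fun a _ => Finset.sum_congr rfl fun b _ => by ring }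
  have hdim : Module.finrank ℂ ((Fin h → ℂ) × (ι → ℂ)) < Module.finrank ℂ (Sym2 (Fin o) → ℂ) := by
    rw [Module.finrank_prod, Module.finrank_fintype_fun_eq_card, Module.finrank_fintype_fun_eq_card,
      Module.finrank_fintype_fun_eq_card, Fintype.card_fin, Sym2.card, Fintype.card_fin]
    exact hcount
  have hker : LinearMap.ker L ≠ ⊥ := LinearMap.ker_ne_bot_of_finrank_lt hdim
  obtain ⟨u, hu, hu0⟩ := Submodule.exists_mem_ne_zero_of_ne_bot hker
  rw [LinearMap.mem_ker] at hu
  have hdiag : ∀ a, Nf u a a = 0 := fun a => by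
    have e := congrArg (fun p : (Fin h → ℂ) × (ι → ℂ) => p.1 a) hu
    simpa [L] using e
  have hiso : ∀ k, ∑ a, ∑ b, A k a * Nf u a b * A k b = 0 := fun k => by
    have e := congrArg (fun p : (Fin h → ℂ) × (ι → ℂ) => p.2 k) hu
    simpa [L] using e
  -- `G · 𝕄 e = 0` off `O`, and `G` has a right inverse on `O`
  have hGM : ∀ i e, ∑ b, G i b * 𝕄 b e = if ω i = e then 𝕄.det else 0 := fun i e => by
    simp only [hG]
    exact sum_adjugate_mul_apply 𝕄 (ω i) e
  refine ⟨Nf u, ?_, hdiag, hiso, ?_, ?_⟩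
  · -- symmetry
    intro a b
    simp only [hNf]
    rw [Finset.sum_comm]
    refine Finset.sum_congr rfl fun i _ => Finset.sum_congr rfl fun j _ => ?_
    rw [Sym2.eq_swap]
    ring
  · -- annihilation of the columns outside `O`
    intro e he a
    have hne : ∀ j, ω j ≠ e := fun j hj => he ⟨j, hj⟩
    simp only [hNf, Finset.sum_mul]
    rw [Finset.sum_comm]
    refine Finset.sum_eq_zero fun i _ => ?_
    rw [Finset.sum_comm]
    refine Finset.sum_eq_zero fun j _ => ?_
    have e1 : ∑ b, G i a * u (s(i, j)) * G j b * 𝕄 b e =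
        G i a * u (s(i, j)) * ∑ b, G j b * 𝕄 b e := by
      rw [Finset.mul_sum]
      exact Finset.sum_congr rfl fun b _ => by ring
    rw [e1, hGM j e, if_neg (hne j), mul_zero]
  · -- `N ≠ 0`: contract with the right inverse `R a i = det⁻¹ 𝕄 a (ω i)`
    by_contra hall
    push Not at hall
    have hzero : ∀ a b, Nf u a b = 0 := by
      intro a b
      by_cases hab : a = b
      · rw [hab]; exact hdiag b
      · exact hall a b hab
    have hδ : ∀ i i', ∑ a, G i a * (𝕄.det⁻¹ * 𝕄 a (ω i')) = if i = i' then 1 else 0 := by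
      intro i i'
      have e1 : ∑ a, G i a * (𝕄.det⁻¹ * 𝕄 a (ω i')) = 𝕄.det⁻¹ * ∑ a, G i a * 𝕄 a (ω i') := by
        rw [Finset.mul_sum]
        exact Finset.sum_congr rfl fun a _ => by ring
      rw [e1, hGM i (ω i')]
      by_cases hii : i = i'
      · rw [if_pos (congrArg ω hii), if_pos hii, inv_mul_cancel₀ hdet]
      · rw [if_neg (fun e => hii (hω e)), if_neg hii, mul_zero]
    apply hu0
    funext z
    induction z using Sym2.ind with
    | h i' j' =>
      rw [Pi.zero_apply]
      -- contract `Nf u` with `R(·, i')` and `R(·, j')`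
      have e2 : ∑ a, ∑ b, (𝕄.det⁻¹ * 𝕄 a (ω i')) * Nf u a b * (𝕄.det⁻¹ * 𝕄 b (ω j')) =
          u (s(i', j')) := by
        calc ∑ a, ∑ b, (𝕄.det⁻¹ * 𝕄 a (ω i')) * Nf u a b * (𝕄.det⁻¹ * 𝕄 b (ω j'))
            = ∑ a, ∑ b, ∑ i, ∑ j, u (s(i, j)) * (G i a * (𝕄.det⁻¹ * 𝕄 a (ω i'))) *
                (G j b * (𝕄.det⁻¹ * 𝕄 b (ω j'))) := by
              refine Finset.sum_congr rfl fun a _ => Finset.sum_congr rfl fun b _ => ?_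
              simp only [hNf, Finset.sum_mul, Finset.mul_sum]
              exact Finset.sum_congr rfl fun i _ => Finset.sum_congr rfl fun j _ => by ring
          _ = ∑ a, ∑ i, ∑ b, ∑ j, u (s(i, j)) * (G i a * (𝕄.det⁻¹ * 𝕄 a (ω i'))) *
                (G j b * (𝕄.det⁻¹ * 𝕄 b (ω j'))) :=
              Finset.sum_congr rfl fun a _ => Finset.sum_comm
          _ = ∑ i, ∑ a, ∑ b, ∑ j, u (s(i, j)) * (G i a * (𝕄.det⁻¹ * 𝕄 a (ω i'))) *
                (G j b * (𝕄.det⁻¹ * 𝕄 b (ω j'))) := Finset.sum_comm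
          _ = ∑ i, ∑ a, ∑ j, ∑ b, u (s(i, j)) * (G i a * (𝕄.det⁻¹ * 𝕄 a (ω i'))) *
                (G j b * (𝕄.det⁻¹ * 𝕄 b (ω j'))) :=
              Finset.sum_congr rfl fun i _ => Finset.sum_congr rfl fun a _ => Finset.sum_comm
          _ = ∑ i, ∑ j, ∑ a, ∑ b, u (s(i, j)) * (G i a * (𝕄.det⁻¹ * 𝕄 a (ω i'))) *
                (G j b * (𝕄.det⁻¹ * 𝕄 b (ω j'))) :=
              Finset.sum_congr rfl fun i _ => Finset.sum_comm
          _ = ∑ i, ∑ j, u (s(i, j)) * (∑ a, G i a * (𝕄.det⁻¹ * 𝕄 a (ω i'))) *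
                (∑ b, G j b * (𝕄.det⁻¹ * 𝕄 b (ω j'))) := by
              refine Finset.sum_congr rfl fun i _ => Finset.sum_congr rfl fun j _ => ?_
              calc ∑ a, ∑ b, u (s(i, j)) * (G i a * (𝕄.det⁻¹ * 𝕄 a (ω i'))) *
                (G j b * (𝕄.det⁻¹ * 𝕄 b (ω j')))
                  = ∑ a, u (s(i, j)) * (G i a * (𝕄.det⁻¹ * 𝕄 a (ω i'))) *
                      ∑ b, G j b * (𝕄.det⁻¹ * 𝕄 b (ω j')) :=
                    Finset.sum_congr rfl fun a _ => by rw [Finset.mul_sum]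
                _ = (∑ a, u (s(i, j)) * (G i a * (𝕄.det⁻¹ * 𝕄 a (ω i')))) *
                      ∑ b, G j b * (𝕄.det⁻¹ * 𝕄 b (ω j')) := by rw [Finset.sum_mul]
                _ = u (s(i, j)) * (∑ a, G i a * (𝕄.det⁻¹ * 𝕄 a (ω i'))) *
                      ∑ b, G j b * (𝕄.det⁻¹ * 𝕄 b (ω j')) := by rw [← Finset.mul_sum]
          _ = ∑ i, ∑ j, u (s(i, j)) * (if i = i' then 1 else 0) * (if j = j' then 1 else 0) := by
              refine Finset.sum_congr rfl fun i _ => Finset.sum_congr rfl fun j _ => ?_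
              rw [hδ i i', hδ j j']
          _ = u (s(i', j')) := by
              simp only [mul_ite, mul_one, mul_zero, Finset.sum_ite_eq', Finset.mem_univ, if_true]
      rw [← e2]
      refine Finset.sum_eq_zero fun a _ => Finset.sum_eq_zero fun b _ => ?_
      rw [hzero a b, mul_zero, zero_mul]

end Summit.ValiantsHypothesis.ValiantsHypothesis.Theorems.BarrierLever.ChowStarve
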